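import Mathlib.Tactic.Ring
import Mathlib.Tactic.NormNum
import Mathlib.Tactic.Linarith
import Mathlib.Algebra.Ring.GrindInstances
import Summits.CriticalPhenomena.PercolationContinuityZ3.Theorems.PercNearOneGluingNoHeavyLowerTailSahiCTCVertexAtoms
import HarnessLib

/-!
# `NoHeavyLowerTail` (crux stmt-CriticalPhenomena-4575), P3 lane: REFLECTIVE CERTIFICATE CHECKING — positivity of the remainder polynomial of a step
# certificate by evaluation (`Lean.Grind.CommRing` normal forms + `native_decide`), and the atom context

Support file (seat `prim-l12-p3`, gen 19; `--supports stmt-CriticalPhenomena-4575`).  Memo `run/shared/lean/prim/prim-l12/FROM-prim-l12-p3-g19-CERTIFICATE-ROAD-G011.md`.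
Nothing is asserted about the crux.

The step certificates of the threshold-certificate programme (g9 §7) are identities `N_j = Σ λ_i·col_i + R` in the 36 region atoms with `R` a
nonnegative-integer combination of atom monomials.  For the degree-3 form `G(0,1,1)` the identities were checked by `ring` (`…SahiCTCG011Id*`); from
`PARA₁` on (degree 4, up to 11 000 monomials) `ring` is far too slow, so the remainder is handled by REFLECTION: `N_j` and the columns are written as
`Lean.Grind.CommRing.Expr` literals over atom variables (core Lean), `R := N_j − Σλ·col` is never written out, and
* `polyCoeffsNonneg` (all coefficients of a `grind` normal form are `≥ 0`) is evaluated on `R.toPoly` by `native_decide` (so the certificate files are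
  `--computational`);
* `cw_of_polyCert` : `polyCoeffsNonneg e.toPoly → ∀ m, 0 ≤ (e.denote ctx).coeff m` when every context entry has nonnegative coefficients (via core's
  `Expr.denote_toPoly`); `cw_powerDenote`, `cw_monDenote`, `cw_polyDenote`;
* `atomCtx V' KX KZ v` : the `RArray` context whose leaf `12a+4b+L` is `atom V' KX KZ v a b L` (`cw_atomCtx` via `rarrayLeaves`/`rarray_get_of_forall`).
The link `N_j = (ExprLiteral).denote (atomCtx …)` is `rfl` after the dictionary/expansion rewriting (see the certificate files).
-/

namespace Summit.CriticalPhenomena.PercolationContinuityZ3.Theorems.SahiCTCForms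

open Finset MvPolynomial SahiCTCGenFun

variable {α : Type*} [DecidableEq α]

section polycert
open Lean.Grind.CommRing

/-- All integer coefficients of a `grind` normal-form polynomial are nonnegative. [this work] -/
def polyCoeffsNonneg : Poly → Bool
  | .num k => decide (0 ≤ k)
  | .add k _ p => decide (0 ≤ k) && polyCoeffsNonneg p

variable (ctx : Context (MvPolynomial α ℤ)) (hctx : ∀ i m, 0 ≤ (ctx.get i).coeff m)
include hctx

/-- Powers of context variables have nonnegative coefficients. [this work] -/
theorem cw_powerDenote (p : Power) : ∀ m, 0 ≤ (p.denote ctx).coeff m := by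
  obtain ⟨x, k⟩ := p
  have hpow : ∀ n : ℕ, ∀ m, 0 ≤ ((ctx.get x) ^ n).coeff m := by
    intro n
    induction n with
    | zero => intro m; rw [pow_zero, coeff_one]; split_ifs <;> decide
    | succ n ih => intro m; rw [pow_succ]; exact coeff_mul_nonneg ih (hctx x) m
  match k with
  | 0 => intro m; show 0 ≤ coeff m (1 : MvPolynomial α ℤ); rw [coeff_one]; split_ifs <;> decide
  | 1 => exact hctx x
  | k + 2 => exact hpow (k + 2)

/-- Monomials in context variables have nonnegative coefficients. [this work] -/
theorem cw_monDenote (mn : Mon) : ∀ m, 0 ≤ (mn.denote ctx).coeff m := by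
  induction mn with
  | unit => intro m; show 0 ≤ coeff m (1 : MvPolynomial α ℤ); rw [coeff_one]; split_ifs <;> decide
  | mult p mn ih => intro m; exact coeff_mul_nonneg (cw_powerDenote ctx hctx p) ih m

/-- A normal-form polynomial with nonnegative integer coefficients, evaluated at polynomials with nonnegative coefficients, has nonnegative
coefficients. [this work] -/
theorem cw_polyDenote (p : Poly) (hp : polyCoeffsNonneg p = true) : ∀ m, 0 ≤ (p.denote ctx).coeff m := by
  induction p with
  | num k =>
    intro m
    have hk : 0 ≤ k := by simpa [polyCoeffsNonneg] using hp
    show 0 ≤ coeff m ((k : ℤ) : MvPolynomial α ℤ)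
    rw [show ((k : ℤ) : MvPolynomial α ℤ) = ((k.toNat : ℕ) : MvPolynomial α ℤ) by
      rw [← Int.cast_natCast, Int.toNat_of_nonneg hk]]
    rw [← map_natCast (C : ℤ →+* MvPolynomial α ℤ), coeff_C]
    split_ifs
    · exact Int.natCast_nonneg _
    · exact le_rfl
  | add k mn p ih =>
    have hk : 0 ≤ k := by simp [polyCoeffsNonneg] at hp; exact hp.1
    have hp' : polyCoeffsNonneg p = true := by simp [polyCoeffsNonneg] at hp; exact hp.2
    intro m
    show 0 ≤ coeff m (k • Mon.denote ctx mn + Poly.denote ctx p)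
    rw [coeff_add]
    refine add_nonneg ?_ (ih hp' m)
    have : (k • Mon.denote ctx mn : MvPolynomial α ℤ) = (k.toNat : ℕ) • Mon.denote ctx mn := by
      rw [← natCast_zsmul, Int.toNat_of_nonneg hk]
    rw [this, coeff_smul, nsmul_eq_mul]
    exact mul_nonneg (Int.natCast_nonneg _) (cw_monDenote ctx hctx mn m)

/-- **Reflective positivity certificate**: if the `grind` normal form of an expression has nonnegative coefficients, then its denotation at a
context of coefficientwise-nonnegative polynomials is coefficientwise nonnegative. [this work] -/
theorem cw_of_polyCert (e : Expr) (h : polyCoeffsNonneg e.toPoly = true) : ∀ m, 0 ≤ (e.denote ctx).coeff m := by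
  have h' := cw_polyDenote ctx hctx e.toPoly h
  rw [Expr.denote_toPoly] at h'
  exact h'

omit hctx

omit [DecidableEq α] in
/-- The leaves of an `RArray`, as a list. [this work] -/
def rarrayLeaves {β : Type*} : Lean.RArray β → List β
  | .leaf x => [x]
  | .branch _ l r => rarrayLeaves l ++ rarrayLeaves r

omit [DecidableEq α] in
/-- Every value of an `RArray` all of whose leaves satisfy `P` satisfies `P`. [this work] -/
theorem rarray_get_of_forall {β : Type*} {P : β → Prop} {a : Lean.RArray β} (h : ∀ x ∈ rarrayLeaves a, P x) (i : ℕ) : P (a.get i) := by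
  induction a with
  | leaf x => exact h x (by simp [rarrayLeaves])
  | branch p l r ihl ihr =>
    show P ((Nat.ble p i).rec (l.get i) (r.get i))
    have hl : ∀ x ∈ rarrayLeaves l, P x := fun x hx => h x (by simp only [rarrayLeaves, List.mem_append]; exact Or.inl hx)
    have hr : ∀ x ∈ rarrayLeaves r, P x := fun x hx => h x (by simp only [rarrayLeaves, List.mem_append]; exact Or.inr hx)
    rcases Bool.eq_false_or_eq_true (Nat.ble p i) with hb | hb <;> rw [hb]
    · exact ihr hr
    · exact ihl hl

end polycert

/-! ### The atom context: the 36 atoms as an `RArray` (variable `12a + 4b + L` ↦ `atom V' KX KZ v a b L`) -/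

section atomctx
variable (V' : Finset α) (KX KZ : Finset (Finset α)) (v : α)

/-- The context of the reflective certificates: leaf `12a + 4b + L` is the atom `α[a,b,L]`. [this work] -/
noncomputable def atomCtx : Lean.RArray (MvPolynomial α ℤ) :=
  (.branch 18 (.branch 9 (.branch 4 (.branch 2 (.branch 1 (.leaf (atom V' KX KZ v 0 0 0)) (.leaf (atom V' KX KZ v 0 0 1))) (.branch 3 (.leaf (atom V' KX KZ v 0 0 2)) (.leaf (atom V' KX KZ v 0 0 3)))) (.branch 6 (.branch 5 (.leaf (atom V' KX KZ v 0 1 0)) (.leaf (atom V' KX KZ v 0 1 1))) (.branch 7 (.leaf (atom V' KX KZ v 0 1 2)) (.branch 8 (.leaf (atom V' KX KZ v 0 1 3)) (.leaf (atom V' KX KZ v 0 2 0)))))) (.branch 13 (.branch 11 (.branch 10 (.leaf (atom V' KX KZ v 0 2 1)) (.leaf (atom V' KX KZ v 0 2 2))) (.branch 12 (.leaf (atom V' KX KZ v 0 2 3)) (.leaf (atom V' KX KZ v 1 0 0)))) (.branch 15 (.branch 14 (.leaf (atom V' KX KZ v 1 0 1)) (.leaf (atom V' KX KZ v 1 0 2)))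 (.branch 16 (.leaf (atom V' KX KZ v 1 0 3)) (.branch 17 (.leaf (atom V' KX KZ v 1 1 0)) (.leaf (atom V' KX KZ v 1 1 1))))))) (.branch 27 (.branch 22 (.branch 20 (.branch 19 (.leaf (atom V' KX KZ v 1 1 2)) (.leaf (atom V' KX KZ v 1 1 3))) (.branch 21 (.leaf (atom V' KX KZ v 1 2 0)) (.leaf (atom V' KX KZ v 1 2 1)))) (.branch 24 (.branch 23 (.leaf (atom V' KX KZ v 1 2 2)) (.leaf (atom V' KX KZ v 1 2 3))) (.branch 25 (.leaf (atom V' KX KZ v 2 0 0)) (.branch 26 (.leaf (atom V' KX KZ v 2 0 1)) (.leaf (atom V' KX KZ v 2 0 2)))))) (.branch 31 (.branch 29 (.branch 28 (.leaf (atom V' KX KZ v 2 0 3)) (.leaf (atom V' KX KZ v 2 1 0))) (.branch 30 (.leaf (atom V' KX KZ v 2 1 1)) (.leaf (atom V' KX KZ v 2 1 2)))) (.branch 33 (.branch 32 (.leaf (atom V' KX KZ v 2 1 3)) (.leaf (atom V' KX KZ v 2 2 0))) (.branch 34 (.leaf (atom V' KX KZ v 2 2 1)) (.branch 35 (.leaf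 (atom V' KX KZ v 2 2 2)) (.leaf (atom V' KX KZ v 2 2 3))))))))

/-- Every leaf of the atom context has nonnegative coefficients. [this work] -/
theorem cw_atomCtx : ∀ i m, 0 ≤ ((atomCtx V' KX KZ v).get i).coeff m :=
  rarray_get_of_forall (P := fun q : MvPolynomial α ℤ => ∀ m, 0 ≤ q.coeff m) (a := atomCtx V' KX KZ v) (by
    intro x hx
    simp only [atomCtx, rarrayLeaves, List.cons_append, List.nil_append, List.mem_cons, List.not_mem_nil, or_false] at hx
    rcases hx with rfl | rfl | rfl | rfl | rfl | rfl | rfl | rfl | rfl | rfl | rfl | rfl | rfl | rfl | rfl | rfl | rfl | rfl | rfl | rfl | rfl | rfl | rfl | rfl | rfl | rfl | rfl | rfl | rfl | rfl | rfl | rfl | rfl | rfl | rfl | rfl <;>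
      exact coeff_atom_nonneg _ _ _ _ _ _ _)

end atomctx

end Summit.CriticalPhenomena.PercolationContinuityZ3.Theorems.SahiCTCForms
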